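import Literature.MathematicalPhysics.QuantumFieldTheory.Balaban1983to89.B9Thm314GFlatV1Transfer
import Literature.MathematicalPhysics.QuantumFieldTheory.Balaban1983to89.B6Prop27KLevelV1

/-!
# `Balaban1983to89.B9Thm314QGQInvFlatV1Transfer` — [B9] THEOREM 3.14 (pp. 426–427, (3.154)) AT `U = 1` FOR THE GENUINE
`k`-LEVEL `(QGQ*)⁻¹ = B6SectAVectorModelV1.EE (domT hN D hk)` ON THE V1 TORUS, FILE Q2 OF 3: THE TRANSFER-RESOLVENT IDENTITY
BETWEEN THE INDEX-BOND LATTICES `𝔅[D]`, `𝔅[D′]` OF TWO FAMILIES AND THE ESTIMATE OF THE DOUBLE SUM — for two nested families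
`{Ω_j}`, `{Ω′_j}` on one torus, `X = QG[Ω]Q*` on `L²(𝔅[D])`, `X′ = QG[Ω′]Q*` on `L²(𝔅[D′])`, `T` the identification of the common
top index bonds: `(QGQ*)⁻¹[D](i,i′) − (QGQ*)⁻¹[D′](i,i′) = Σ_{u,v} (QGQ*)⁻¹[D](i,u)·(TX′ − XT)(u,v)·(QGQ*)⁻¹[D′](v,i′)`, every
surviving term carries the factor `e^{−½δd(y,y′,Ω)}`, and the double sum is summed by Lemma 2.1 twice (hypothesis-level engine:
theorems + one `def` with body, the transfer kernel; no existing module is touched; no fact is minted)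

FRAMING (verbatim cell line):
statement-level skeleton of published theorems with citation tags; proofs where landed; nothing here is a claim about the Yang–Mills mass gap

Sources under audit (cell lit-balaban): T. Bałaban, *Propagators for lattice gauge theories in a background field*, Commun.
Math. Phys. **99** (1985) 389–434 [`Balaban1985BackgroundPropagators`, "B9"], pp. 426–427 [PDF 38–39] (Theorem 3.14, (3.154)) —
held text `paper:balaban1985-cmp99-background-propagators` p0038/p0039 re-read this generation; T. Bałaban, *Propagators and
renormalization transformations for lattice gauge theories. II*, Commun. Math. Phys. **96** (1984) 223–250
[`Balaban1984PropagatorsII`, "[4]"], Prop. 2.7 (2.149) p. 249, (2.142)/(2.147) p. 248, (2.81) p. 237, (2.46) p. 231, Lemma 2.1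
(2.61) p. 234.  Unit `lit-balaban-p21` (Phase-2 proof seat p21 gen 24, HOME `run/shared/lean/pub/lit-balaban/`, free-target
protocol G.5-34(d), TAKING 2026-08-25T03:23Z; B9 fold owner r06, B6 fold owner r03 (author of the consumed `B6Ineq2142KLevelV1` /
`B6Prop27KLevelV1` / `B6QGQCoerciveKLevelV1`), referee ref-4).  Companion files: Q1 `B9Thm314QGQFlatV1` (the two-family (2.142) on
common top pairs, discharging `hΔ` below), Q3 `B9Thm314QGQInvFlatV1MultiLevelTorus` (instantiation).

## WHAT IS PRINTED (quotations AS PRINTED; «…» marks our elisions)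

B9 p. 426: «Let us assume that we have two sequences of domains {Ω_j}, {Ω′_j}, both satisfying the conditions (2.1)–(2.4) in [4],
with M and R sufficiently large «…». We construct operators for both sequences and we define Ω = Ω_k ∩ Ω′_k. Let us take
localizations determined by points y, y′ ∈ Ω^{(k)} (i.e. these are cubes Δ̃(y), Δ̃(y′) in the case of operators G′, G, G₁, 𝔊, the
cube Δ̃(y) and the point y′ in the case of H, H₁, and the points y, y′ in the case of (Q′G′²Q′*)⁻¹, (QGQ*)⁻¹, etc.). We have
**Theorem 3.14.** If we take a pair of operators constructed for the two sequences {Ω_j}, {Ω′_j}, then their difference satisfies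
all the inequalities characteristic for operators of the considered type, with the additional factor
exp(−δ₀d(y, y′, Ω)), d(y, y′, Ω) = inf_{y₁∈Ωᶜ∩T^{(k)}} (|y − y₁| + |y₁ − y′|) (3.154) on the right-hand sides.» (p. 427)
«We take random walk expansions for both operators, and in the difference all terms for walks with localizations contained in Ω
are cancelled. Remaining terms correspond to walks of the general type (3.107), for which at least one localization X_i
intersects Ωᶜ. Then the exponential factor in (3.108) gives the factor (3.154) (after adjusting a definition of δ₀).»
[4] p. 249: «**Proposition 2.7.** The operator (QGQ*)⁻¹ is given by the convergent expansions of the form (2.86), and it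
satisfies the bound |(QGQ*)⁻¹(b, b′)| ≤ O(1)(L^jη)^{−2}(L^{j′}η)^{−d}e^{−½δ₄d(b,b′)}, b ∈ Λ_j, b′ ∈ Λ_{j′}. (2.149)»; p. 248: «From (2.136) we have
|(QGQ*)(b, b′)| ≤ O(1)(L^jη)²(L^{j′}η)^{−d}e^{−δ₃d(b,b′)}, b ∈ Λ_j, b′ ∈ Λ_{j′}. (2.142)».

v1.1 (doc-only, D-g108-1 of ref-4 gen 108): the quotation of [4] Proposition 2.7 (2.149) p. 249 above is now verbatim (v1.0 had
paraphrased it as «uniquely determined by (2.143)–(2.146) … (L^jη)^{d−2}η^{−2}e^{−δ₄d(b,b′)} … b′ ∈ 𝔅»); declarations byte-identical.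

## WHAT THIS FILE CERTIFIES (kernel-checked; V1 torus `B6GlobalChartV1.PV`, families `domT hN D hk` of p21's `TDomains`; lattice units)

For two families `D, D′ : TDomains` on one torus (`hN`), index bonds `BondIdx (domT hN D hk)` / `BondIdx (domT hN D′ hk)` (r03's
W2/W3 setting: levels `lvl`, carrier blocks `β`, conjugation weights `Λ = lam`, `ρ(a,b) = d_T(β a, β b)`), the common top index
bonds `IsCT` of `B9Thm314GFlatV1Kernel` (level `k`, in `Λ_k ∩ Λ′_k`; twins `ũ = ⟨u.1, _⟩`), and the (3.154) distance
`dOmega D D′` of `B9Thm314GpFlatTorusGeometry` on `k`-labels: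
* §1 the flat ENTRIES `ent T a b = (T e_b)(a) = ⟪e_a, T e_b⟫` of operators on `L²(𝔅)`, `ent_comp`, `ent_id`; `X = ent (QGQ*)`
  (`X_eq_ent`, r03's `B6Ineq2142KLevelV1.X`), `inner_EE_eq_ent`; the resolvent identities entrywise `sum_entEE_mul_X` /
  `sum_X_mul_entEE` (`B6SectAVectorModelV1.EE_comp` / `comp_EE`);
* §2 **`transKer`** — `M(u, v) = [u common top]·X′(ũ, v) − [v common top]·X(u, v_D)` — and **`entEE_sub_eq`**: for common top
  `i`, `i′`, `(QGQ*)⁻¹[D](i, i′_D) − (QGQ*)⁻¹[D′](ĩ, i′) = Σ_{u∈𝔅[D]} Σ_{v∈𝔅[D′]} (QGQ*)⁻¹[D](i,u)·M(u,v)·(QGQ*)⁻¹[D′](v,i′)`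
  (pure algebra from the two resolvent identities: the form, at `U = 1`, of print's cancellation of the walks inside `Ω`);
* §3 geometry of index bonds for (3.154): `lam_twin` (`Λ′_ũ = Λ_u`), `beta_lab_eq`, **`tdistK_twin_le`** (`|β u − β′ ũ| ≤ 3` on
  `T^{(k)}`: both base sites lie in the tube of the common bond), `tdistK_le_rho_of_top` (`|β a − β b| ≤ ρ(a,b)` for top bonds),
  **`exists_witness_of_not_isCT`** (a surviving index bond charges a site whose `k`-lattice point is in `Ωᶜ ∩ T^{(k)}`, within
  `L + 2` blocks of its carrier block — `B9Thm314GFlatV1Kernel.witness_of_not_isCT` + `B6Ineq2142KLevelV1.geomT_dist_ends_le`);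
* §4 **`term_le`**: from the (2.149) bounds `|(QGQ*)⁻¹(a,b)| ≤ SΛ_a⁻¹Λ_b⁻¹e^{−δρ(a,b)}` (both families), the (2.142) bounds
  `|X(a,b)| ≤ A′Λ_aΛ_be^{−δρ(a,b)}` (both families) and the two-family bound `|X′(ũ,v) − X(u,v_D)| ≤ C_ΔΛ_uΛ′_ve^{−δd(βu,β′v,Ω)}`
  on common top pairs (file Q1), for common top `i, i′` and ANY `u, v`:
  `|(QGQ*)⁻¹(i,u)|·|M(u,v)|·|(QGQ*)⁻¹′(v,i′)| ≤ S²(C_Δ+A′)e^{½δ(2ℓ+11)}·Λ_i⁻¹Λ′_{i′}⁻¹·e^{−½δd(βi,β′i′,Ω)}·e^{−¼δρ(i,u)}·e^{−¼δρ′(i′,v)}`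
  (three surviving cases as print's «at least one localization X_i intersects Ωᶜ»; the conjugation weights of `u`, `v` CANCEL —
  no (2.60) scale transfer is needed in the `Λ`-currency of [3] Sect. 5);
* §5 **`transfer_bound`** (the double sum by the Lemma-2.1 profiles of the two index-bond lattices at rate `¼δ`) and §6
  **`thm314_QGQinv_of_hyps`**: the geometric mean with the plain (2.149) decays (`B9Thm314GpFlatMultiLevelTorus.combined_bound`):
  `|⟪e_i,(QGQ*)⁻¹[D]e_{i′_D}⟫ − ⟪e_ĩ,(QGQ*)⁻¹[D′]e_{i′}⟫| ≤ √(2S)√(S²(C_Δ+A′)e^{½δ(2ℓ+11)}K_sK_s′)·Λ_i⁻¹Λ′_{i′}⁻¹·e^{−½δ min(ρ(i,i′_D),ρ′(ĩ,i′))}·e^{−¼δd(βi,β′i′,Ω)}`.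

## HONEST SCOPE

* `U = 1` only (no background field; B9 states Theorem 3.14 for regular `U`); V1 torus lineage (`Ω₁ = T_η`, levels `1 … k`,
  lattice units, `D = d + 1` space-time dimensions); HYPOTHESIS-LEVEL in the five kernel bounds and the two profiles (fed in file
  Q3 from r03's `prop27_kLevel_unconditional` / `ineq2142_kLevel`, file Q1 and `lemma21_torus`).  Only COMMON TOP index bonds
  `i, i′` (print's «points y, y′ ∈ Ω^{(k)}»); (3.154) as in `B9Thm314GpFlatTorusGeometry` (`k`-block labels of the carrier
  blocks `β`, torus sup-distance in units of `L^k`, `inf ∅ := 0`); `Λ_i⁻¹Λ′_{i′}⁻¹ = c_f²(L^k)^{D−2}` for top bonds.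
* ROUTE (declared): print's walk-expansion cancellation is replaced by the transfer-resolvent identity §2 (the inverse of r03's
  `B6Prop27KLevelV1` is obtained by [3] Sect. 5 on the whole index-bond lattice, not by an expansion); the surviving terms are
  classified by which of `u`, `v` is a common top index bond, exactly as print's «at least one localization X_i intersects Ωᶜ».
  Same architecture as this seat's gen-19 `B9Thm314QGGQInvFlatTransfer` for `(Q′G′²Q′*)⁻¹`.  Constants ours, not optimised.
  Nothing is inferred from the manuscript: every step is kernel-checked; the quoted sentences locate the statements.  NOT summit
  progress.
-/

noncomputable section

open scoped BigOperators InnerProductSpace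
open Finset

namespace Literature.MathematicalPhysics.QuantumFieldTheory.Balaban1983to89.B9Thm314QGQInvFlatV1Transfer

open B4Reflection242 (boxDom blk)
open B6MultiLevelBoxOperator (N0)
open B6MultiLevelTorusOperator (TDomains)
open B6Geom246MultiLevelBox (bset blkOf blkOf_val)
open B6Geom246MultiLevelTorus (geomT)
open B6SectAOperatorsV1 (QE QsE BondIdx BondIdxSpace)
open B6SectAVectorModelV1 (GE EE EE_comp comp_EE)
open B6GlobalChartV1 (PV toBox domT)
open B6Ineq2142KLevelV1 (lvl lvl_le_mK base baseSite iterBlockOf_baseSite β beta_level X)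
open B6Prop27KLevelV1 (wt lam lam_pos rho)
open B9Thm314GpFlatTorusGeometry (OmegaC tdistK tdistK_nonneg dOmega dOmega_nonneg dOmega_le)
open B9Thm314QGGQInvFlatTransfer (tdistK_triangle tdistK_comm dOmega_le_tdistK_add dOmega_le_add_tdistK tdistK_le_distT_of_top)
open B9Thm314GFlatV1Transfer (tdistK_blk_le_of_top tdistK_blk_blk_le_of_dist dist_tube_le dOmega_le_chain)
open B9Thm314GFlatV1Kernel (IsCT witness_of_not_isCT witness_of_not_isCT' sum_qk qk)
open B5Eq118OneStroke (iterBlockOf)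
open B8Prop3MultiLevelTorus (iterBlockOf_of_bondAvgIter_single_ne_zero)
open LatticeFieldCalculus (bondAvgIter)
open B6Ineq2142KLevelV1 (geomT_dist_ends_le)

variable {d ℓ m K : ℕ} {hd : 1 ≤ d + 1} {hL : Odd (ℓ + 1) ∧ 1 < ℓ + 1}
variable {Mh k R : ℕ} {P' : Fin (d + 1) → ℕ}

/-! ## §1  Entries of operators on `L²(𝔅)` in the flat basis; `X = QGQ*` and `(QGQ*)⁻¹` as entry families -/

section Entries

variable (hN : ∀ μ, N0 ℓ Mh k P' μ = (PV d ℓ m K hd hL).sitesPerDir 0) (D₀ : TDomains d ℓ Mh k P' R) (hk : k ≤ m + K)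

/-- the flat entry `T(a, b) = (T e_b)(a) = ⟪e_a, T e_b⟫` of an operator on `L²(𝔅)` («sites replaced by bonds», p. 248).
[cite: Balaban1984PropagatorsII, p.248 («We consider these operators on the L²-space … with sites replaced by bonds»), dictionary] -/
def ent (T : BondIdxSpace (domT hN D₀ hk) →ₗ[ℝ] BondIdxSpace (domT hN D₀ hk)) (a b : BondIdx (domT hN D₀ hk)) : ℝ :=
  T (EuclideanSpace.single b (1 : ℝ)) a

/-- `T(a, b) = ⟪e_a, T e_b⟫`. [cite: Balaban1984PropagatorsII, p.248, dictionary] -/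
theorem ent_eq_inner (T : BondIdxSpace (domT hN D₀ hk) →ₗ[ℝ] BondIdxSpace (domT hN D₀ hk)) (a b : BondIdx (domT hN D₀ hk)) :
    ent hN D₀ hk T a b = ⟪EuclideanSpace.single a (1 : ℝ), T (EuclideanSpace.single b (1 : ℝ))⟫_ℝ := by
  rw [EuclideanSpace.inner_single_left]; simp [ent]

/-- **ENTRIES OF A COMPOSITE**: `(ST)(a, b) = Σ_c S(a, c)T(c, b)`. [cite: Balaban1984PropagatorsII, p.248, dictionary] -/
theorem ent_comp (S T : BondIdxSpace (domT hN D₀ hk) →ₗ[ℝ] BondIdxSpace (domT hN D₀ hk)) (a b : BondIdx (domT hN D₀ hk)) :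
    ent hN D₀ hk (S ∘ₗ T) a b = ∑ c, ent hN D₀ hk S a c * ent hN D₀ hk T c b := by
  classical
  simp only [ent_eq_inner]
  have hrepr := (EuclideanSpace.basisFun (BondIdx (domT hN D₀ hk)) ℝ).sum_repr' (T (EuclideanSpace.single b (1 : ℝ)))
  simp only [EuclideanSpace.basisFun_apply] at hrepr
  conv_lhs => rw [LinearMap.comp_apply, ← hrepr, map_sum, inner_sum]
  refine Finset.sum_congr rfl fun c _ => ?_
  rw [map_smul, real_inner_smul_right, mul_comm]

/-- `1(a, b) = δ_{ab}`. [cite: Balaban1984PropagatorsII, p.248, dictionary] -/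
theorem ent_id (a b : BondIdx (domT hN D₀ hk)) :
    ent hN D₀ hk LinearMap.id a b = if a = b then 1 else 0 := by
  unfold ent
  rw [LinearMap.id_apply]
  exact PiLp.single_apply _ _ _ _ _

variable {cf : ℝ} (hcf : cf ≠ 0) {w : BondIdx (domT hN D₀ hk) → ℝ} (hw : ∀ i, 0 < w i)

/-- `X(a, b) = (QGQ*)(a, b)` (r03's flat matrix IS the entry family of `QGQ*`). [cite: Balaban1984PropagatorsII, (2.142) p.248] -/
theorem X_eq_ent (a b : BondIdx (domT hN D₀ hk)) :
    X hN D₀ hk hcf hw a b = ent hN D₀ hk (QE (domT hN D₀ hk) ∘ₗ GE (domT hN D₀ hk) hcf hw ∘ₗ QsE (domT hN D₀ hk)) a b := rfl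

/-- `⟪e_a, (QGQ*)⁻¹e_b⟫ = (QGQ*)⁻¹(a, b)`. [cite: Balaban1984PropagatorsII, Prop. 2.7 (2.149) p.249, dictionary] -/
theorem inner_EE_eq_ent (a b : BondIdx (domT hN D₀ hk)) :
    ⟪EuclideanSpace.single a (1 : ℝ), EE (domT hN D₀ hk) hcf hw (EuclideanSpace.single b (1 : ℝ))⟫_ℝ
      = ent hN D₀ hk (EE (domT hN D₀ hk) hcf hw) a b :=
  (ent_eq_inner hN D₀ hk _ a b).symm

/-- **`(QGQ*)⁻¹(QGQ*) = 1` ENTRYWISE**: `Σ_u (QGQ*)⁻¹(i, u)·X(u, a) = δ_{ia}`. [cite: Balaban1984PropagatorsII, (2.35) p.228, Prop. 2.7 p.249] -/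
theorem sum_entEE_mul_X (i a : BondIdx (domT hN D₀ hk)) :
    ∑ u, ent hN D₀ hk (EE (domT hN D₀ hk) hcf hw) i u * X hN D₀ hk hcf hw u a = if i = a then 1 else 0 := by
  simp only [X_eq_ent]
  rw [← ent_comp, EE_comp, ent_id]

/-- **`(QGQ*)(QGQ*)⁻¹ = 1` ENTRYWISE**: `Σ_v X(b, v)·(QGQ*)⁻¹(v, i′) = δ_{bi′}`. [cite: Balaban1984PropagatorsII, (2.35) p.228, Prop. 2.7 p.249] -/
theorem sum_X_mul_entEE (b i' : BondIdx (domT hN D₀ hk)) :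
    ∑ v, X hN D₀ hk hcf hw b v * ent hN D₀ hk (EE (domT hN D₀ hk) hcf hw) v i' = if b = i' then 1 else 0 := by
  simp only [X_eq_ent]
  rw [← ent_comp, comp_EE, ent_id]

end Entries

/-! ## §2  The transfer kernel `M = T·X′ − X·T` between `𝔅[D]` and `𝔅[D′]` and the identity
`(QGQ*)⁻¹[D](i, i′) − (QGQ*)⁻¹[D′](i, i′) = Σ_{u,v} (QGQ*)⁻¹[D](i, u)·M(u, v)·(QGQ*)⁻¹[D′](v, i′)` -/

section Transfer

variable (hN : ∀ μ, N0 ℓ Mh k P' μ = (PV d ℓ m K hd hL).sitesPerDir 0) (D D' : TDomains d ℓ Mh k P' R) (hk : k ≤ m + K)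
variable {cf : ℝ} (hcf : cf ≠ 0) {w : BondIdx (domT hN D hk) → ℝ} (hw : ∀ i, 0 < w i)
  {w' : BondIdx (domT hN D' hk) → ℝ} (hw' : ∀ i, 0 < w' i)

open Classical in
/-- **THE TRANSFER KERNEL** between the index bonds of the two families: with `X = QG[Ω]Q*` on `L²(𝔅[D])`, `X′ = QG[Ω′]Q*`
on `L²(𝔅[D′])` and `T` the identification of the COMMON TOP index bonds (`IsCT`: level `k`, in `Λ_k ∩ Λ′_k`),
`M(u, v) = [u common top]·X′(u, v) − [v common top]·X(u, v)` = the entries of `T·X′ − X·T`.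
[cite: Balaban1985BackgroundPropagators, Thm 3.14 p.427 («in the difference all terms for walks with localizations contained in Ω are cancelled»), dictionary] -/
def transKer (u : BondIdx (domT hN D hk)) (v : BondIdx (domT hN D' hk)) : ℝ :=
  (if h : IsCT hN D D' hk u.1 then X hN D' hk hcf hw' ⟨u.1, h.2.2⟩ v else 0)
  - (if h : IsCT hN D D' hk v.1 then X hN D hk hcf hw u ⟨v.1, h.2.1⟩ else 0)

/-- **THE TRANSFER-RESOLVENT IDENTITY, ENTRYWISE**: for common top index bonds `i` (read in `𝔅[D]`) and `i′` (read in `𝔅[D′]`),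
`(QGQ*)⁻¹[D](i, i′) − (QGQ*)⁻¹[D′](i, i′) = Σ_{u∈𝔅[D]} Σ_{v∈𝔅[D′]} (QGQ*)⁻¹[D](i, u)·M(u, v)·(QGQ*)⁻¹[D′](v, i′)` — from
`(QGQ*)⁻¹(QGQ*) = 1` on `L²(𝔅[D])` and `(QGQ*)(QGQ*)⁻¹ = 1` on `L²(𝔅[D′])` (the algebraic form, at `U = 1`, of the cancellation of
the walks inside `Ω`). [cite: Balaban1985BackgroundPropagators, Thm 3.14 p.427; Balaban1984PropagatorsII, Prop. 2.7 p.249] -/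
theorem entEE_sub_eq (i : BondIdx (domT hN D hk)) (hi : IsCT hN D D' hk i.1)
    (i' : BondIdx (domT hN D' hk)) (hi' : IsCT hN D D' hk i'.1) :
    ent hN D hk (EE (domT hN D hk) hcf hw) i ⟨i'.1, hi'.2.1⟩ - ent hN D' hk (EE (domT hN D' hk) hcf hw') ⟨i.1, hi.2.2⟩ i'
      = ∑ u : BondIdx (domT hN D hk), ∑ v : BondIdx (domT hN D' hk),
          ent hN D hk (EE (domT hN D hk) hcf hw) i u * transKer hN D D' hk hcf hw hw' u v
            * ent hN D' hk (EE (domT hN D' hk) hcf hw') v i' := by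
  classical
  -- the first half: `Σ_u E(i,u)[u ct] Σ_v X′(u,v)E′(v,i′) = E(i, i′)`
  have hT1 : ∀ u : BondIdx (domT hN D hk),
      (∑ v, (if h : IsCT hN D D' hk u.1 then X hN D' hk hcf hw' ⟨u.1, h.2.2⟩ v else 0)
          * ent hN D' hk (EE (domT hN D' hk) hcf hw') v i')
        = if u = ⟨i'.1, hi'.2.1⟩ then 1 else 0 := by
    intro u
    by_cases hu : IsCT hN D D' hk u.1
    · simp only [dif_pos hu]
      rw [sum_X_mul_entEE]
      have e : ((⟨u.1, hu.2.2⟩ : BondIdx (domT hN D' hk)) = i') ↔ (u = ⟨i'.1, hi'.2.1⟩) := by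
        constructor
        · intro h; apply Subtype.ext; have h1 := congrArg Subtype.val h; exact h1
        · intro h; apply Subtype.ext; have h1 := congrArg Subtype.val h; exact h1
      by_cases h' : u = ⟨i'.1, hi'.2.1⟩
      · rw [if_pos h', if_pos (e.2 h')]
      · rw [if_neg h', if_neg (fun h => h' (e.1 h))]
    · simp only [dif_neg hu, zero_mul, Finset.sum_const_zero]
      have h' : u ≠ ⟨i'.1, hi'.2.1⟩ := by
        rintro rfl
        exact hu hi'
      rw [if_neg h']
  -- the second half: `Σ_v [v ct] (Σ_u E(i,u)X(u,v)) E′(v,i′) = E′(i, i′)`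
  have hT2 : ∀ v : BondIdx (domT hN D' hk),
      (∑ u, ent hN D hk (EE (domT hN D hk) hcf hw) i u *
          (if h : IsCT hN D D' hk v.1 then X hN D hk hcf hw u ⟨v.1, h.2.1⟩ else 0))
        = if v = ⟨i.1, hi.2.2⟩ then 1 else 0 := by
    intro v
    by_cases hv : IsCT hN D D' hk v.1
    · simp only [dif_pos hv]
      rw [sum_entEE_mul_X]
      have e : (i = (⟨v.1, hv.2.1⟩ : BondIdx (domT hN D hk))) ↔ (v = ⟨i.1, hi.2.2⟩) := by
        constructor
        · intro h; apply Subtype.ext; have h1 := congrArg Subtype.val h; exact h1.symm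
        · intro h; apply Subtype.ext; have h1 := congrArg Subtype.val h; exact h1.symm
      by_cases h' : v = ⟨i.1, hi.2.2⟩
      · rw [if_pos h', if_pos (e.2 h')]
      · rw [if_neg h', if_neg (fun h => h' (e.1 h))]
    · simp only [dif_neg hv, mul_zero, Finset.sum_const_zero]
      have h' : v ≠ ⟨i.1, hi.2.2⟩ := by
        rintro rfl
        exact hv hi
      rw [if_neg h']
  -- assemble (no `congr`: the index types are heavy)
  have eA : (∑ u : BondIdx (domT hN D hk), ∑ v : BondIdx (domT hN D' hk),
        ent hN D hk (EE (domT hN D hk) hcf hw) i u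
          * (if h : IsCT hN D D' hk u.1 then X hN D' hk hcf hw' ⟨u.1, h.2.2⟩ v else 0)
          * ent hN D' hk (EE (domT hN D' hk) hcf hw') v i')
      = ∑ u, ent hN D hk (EE (domT hN D hk) hcf hw) i u *
          ∑ v, (if h : IsCT hN D D' hk u.1 then X hN D' hk hcf hw' ⟨u.1, h.2.2⟩ v else 0)
            * ent hN D' hk (EE (domT hN D' hk) hcf hw') v i' :=
    Finset.sum_congr rfl fun u _ => by
      rw [Finset.mul_sum]
      exact Finset.sum_congr rfl fun v _ => by ring
  have eB : (∑ u : BondIdx (domT hN D hk), ∑ v : BondIdx (domT hN D' hk),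
        ent hN D hk (EE (domT hN D hk) hcf hw) i u
          * (if h : IsCT hN D D' hk v.1 then X hN D hk hcf hw u ⟨v.1, h.2.1⟩ else 0)
          * ent hN D' hk (EE (domT hN D' hk) hcf hw') v i')
      = ∑ v, (∑ u, ent hN D hk (EE (domT hN D hk) hcf hw) i u *
            (if h : IsCT hN D D' hk v.1 then X hN D hk hcf hw u ⟨v.1, h.2.1⟩ else 0))
            * ent hN D' hk (EE (domT hN D' hk) hcf hw') v i' := by
    rw [Finset.sum_comm]
    exact Finset.sum_congr rfl fun v _ => by rw [Finset.sum_mul]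
  have h1 : (∑ u, ent hN D hk (EE (domT hN D hk) hcf hw) i u *
          ∑ v, (if h : IsCT hN D D' hk u.1 then X hN D' hk hcf hw' ⟨u.1, h.2.2⟩ v else 0)
            * ent hN D' hk (EE (domT hN D' hk) hcf hw') v i')
      = ent hN D hk (EE (domT hN D hk) hcf hw) i ⟨i'.1, hi'.2.1⟩ := by
    rw [Finset.sum_congr rfl fun u _ => by rw [hT1 u]]
    simp only [mul_ite, mul_one, mul_zero, Finset.sum_ite_eq', Finset.mem_univ, if_true]
  have h2 : (∑ v, (∑ u, ent hN D hk (EE (domT hN D hk) hcf hw) i u *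
            (if h : IsCT hN D D' hk v.1 then X hN D hk hcf hw u ⟨v.1, h.2.1⟩ else 0))
            * ent hN D' hk (EE (domT hN D' hk) hcf hw') v i')
      = ent hN D' hk (EE (domT hN D' hk) hcf hw') ⟨i.1, hi.2.2⟩ i' := by
    rw [Finset.sum_congr rfl fun v _ => by rw [hT2 v]]
    simp only [ite_mul, one_mul, zero_mul, Finset.sum_ite_eq', Finset.mem_univ, if_true]
  rw [← h1, ← h2, ← eA, ← eB, ← Finset.sum_sub_distrib]
  refine Finset.sum_congr rfl fun u _ => ?_
  rw [← Finset.sum_sub_distrib]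
  refine Finset.sum_congr rfl fun v _ => ?_
  unfold transKer
  ring

end Transfer

/-! ## §3  Geometry of the index bonds for (3.154): twins, labels of the carrier blocks, the `Ωᶜ` witnesses -/

section Geometry

variable (hN : ∀ μ, N0 ℓ Mh k P' μ = (PV d ℓ m K hd hL).sitesPerDir 0) (D D' : TDomains d ℓ Mh k P' R) (hk : k ≤ m + K)

/-- **THE WEIGHTS OF TWINS AGREE**: `Λ′_{ũ} = Λ_u` for the twin `ũ ∈ 𝔅[D′]` of a common top index bond `u ∈ 𝔅[D]` (both have level `k`;
`Λ` is a function of the level). [cite: Balaban1984PropagatorsII, (2.81) p.237, (2.142) p.248, bookkeeping] -/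
theorem lam_twin (cf : ℝ) (u : BondIdx (domT hN D hk)) (h : IsCT hN D D' hk u.1) :
    lam hN D' hk cf ⟨u.1, h.2.2⟩ = lam hN D hk cf u := rfl

/-- … and `Λ_{v_D} = Λ′_v` for the twin `v_D ∈ 𝔅[D]` of a common top `v ∈ 𝔅[D′]`. [cite: Balaban1984PropagatorsII, (2.81) p.237, bookkeeping] -/
theorem lam_twin' (cf : ℝ) (v : BondIdx (domT hN D' hk)) (h : IsCT hN D D' hk v.1) :
    lam hN D hk cf ⟨v.1, h.2.1⟩ = lam hN D' hk cf v := rfl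

/-- **THE LABEL OF THE CARRIER BLOCK OF A TOP INDEX BOND** is the `k`-label of (any site of) its base block.
[cite: Balaban1984PropagatorsII, (2.45) p.231, bookkeeping] -/
theorem beta_lab_eq (D₀ : TDomains d ℓ Mh k P' R) (hk1 : 1 ≤ k) (u : BondIdx (domT hN D₀ hk)) (hu : (u.1.1 : ℕ) = k) :
    (β hN D₀ hk u).1.2 = blk ((ℓ + 1) ^ k) (toBox hN (baseSite hN D₀ hk u)).1 := by
  have h1 := beta_level hN D₀ hk hk1 u
  unfold β at h1 ⊢
  rw [blkOf_val] at h1 ⊢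
  simp only at h1 ⊢
  change D₀.toDomains.lev (toBox hN (baseSite hN D₀ hk u)).1 = (u.1.1 : ℕ) at h1
  rw [h1, hu]

/-- the base site of an index bond lies in its tube (`B^j(c₋) ∪ B^j(c₊)`). [cite: Balaban1984PropagatorsI, (1.18) p.20, bookkeeping] -/
theorem baseSite_mem_tube (D₀ : TDomains d ℓ Mh k P' R) (u : BondIdx (domT hN D₀ hk)) :
    iterBlockOf (lvl hN D₀ hk u) (baseSite hN D₀ hk u) = u.1.2.src ∨ iterBlockOf (lvl hN D₀ hk u) (baseSite hN D₀ hk u) = u.1.2.tgt := by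
  rw [iterBlockOf_baseSite]
  rcases B6Ineq2142KLevelV1.ends_eq hN D₀ hk u with h | h
  · exact Or.inl h.1
  · exact Or.inr h.1

/-- **THE CARRIER BLOCKS OF TWINS ARE `k`-NEIGHBOURS**: `|β u − β′ ũ| ≤ 3` on `T^{(k)}` (both base sites lie in the tube of the common bond,
torus diameter `≤ 2L^k`). [cite: Balaban1985BackgroundPropagators, (3.154) p.427; Balaban1984PropagatorsI, (1.18) p.20] -/
theorem tdistK_twin_le (u : BondIdx (domT hN D hk)) (h : IsCT hN D D' hk u.1) (hk1 : 1 ≤ k) :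
    tdistK (ℓ := ℓ) (Mh := Mh) (k := k) (P := P') (β hN D hk u).1.2 (β hN D' hk ⟨u.1, h.2.2⟩).1.2 ≤ 3 := by
  have hu : (u.1.1 : ℕ) = k := h.1
  rw [beta_lab_eq hN hk D hk1 u hu, beta_lab_eq hN hk D' hk1 ⟨u.1, h.2.2⟩ hu]
  have hx := baseSite_mem_tube hN hk D u
  have hx' := baseSite_mem_tube hN hk D' ⟨u.1, h.2.2⟩
  have hjm : (u.1.1 : ℕ) ≤ m + K := lvl_le_mK hN D hk u
  have hjk : (u.1.1 : ℕ) ≤ k := hu.le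
  have hdist := dist_tube_le hN hjm hjk u.1.2 hx hx'
  have := tdistK_blk_blk_le_of_dist (z := toBox hN (baseSite hN D hk u)) (w := toBox hN (baseSite hN D' hk ⟨u.1, h.2.2⟩))
    (n := 2) (by exact_mod_cast hdist)
  linarith

/-- the same for a common top `v ∈ 𝔅[D′]` and its twin `v_D ∈ 𝔅[D]`. [cite: Balaban1985BackgroundPropagators, (3.154) p.427] -/
theorem tdistK_twin_le' (v : BondIdx (domT hN D' hk)) (h : IsCT hN D D' hk v.1) (hk1 : 1 ≤ k) :
    tdistK (ℓ := ℓ) (Mh := Mh) (k := k) (P := P') (β hN D hk ⟨v.1, h.2.1⟩).1.2 (β hN D' hk v).1.2 ≤ 3 := by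
  have h' : IsCT hN D D' hk (⟨v.1, h.2.1⟩ : BondIdx (domT hN D hk)).1 := h
  exact tdistK_twin_le hN D D' hk ⟨v.1, h.2.1⟩ h' hk1

/-- **`|β a − β b| ≤ ρ(a, b)` FOR TOP INDEX BONDS** of one family (their carrier blocks are top blocks).
[cite: Balaban1984PropagatorsII, (2.46) p.231; Balaban1985BackgroundPropagators, (3.154) p.427] -/
theorem tdistK_le_rho_of_top (D₀ : TDomains d ℓ Mh k P' R) (hMh : 1 ≤ Mh) (hP : ∀ μ, 1 ≤ P' μ) (hk1 : 1 ≤ k)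
    (a b : BondIdx (domT hN D₀ hk)) (ha : (a.1.1 : ℕ) = k) (hb : (b.1.1 : ℕ) = k) :
    tdistK (ℓ := ℓ) (Mh := Mh) (k := k) (P := P') (β hN D₀ hk a).1.2 (β hN D₀ hk b).1.2 ≤ rho hN D₀ hk a b := by
  have ha' : (β hN D₀ hk a).1.1 = k := (beta_level hN D₀ hk hk1 a).trans ha
  have hb' : (β hN D₀ hk b).1.1 = k := (beta_level hN D₀ hk hk1 b).trans hb
  exact tdistK_le_distT_of_top D₀ hMh hP ha' hb'

/-- **A SURVIVING INDEX BOND OF `{Ω_j}` MEETS `Ωᶜ` NEARBY**: if `u ∈ 𝔅[D]` is not a common top index bond, some site `z` of its tube has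
its `k`-lattice point in `Ωᶜ ∩ T^{(k)}`, and the block of `z` is within `L + 2` of the carrier block `β u`.
[cite: Balaban1985BackgroundPropagators, Thm 3.14 p.427 («at least one localization X_i intersects Ωᶜ»); Balaban1984PropagatorsII, (2.3) p.224] -/
theorem exists_witness_of_not_isCT (hk1 : 1 ≤ k) (hRM : 2 ≤ R * Mh) (hMh : 1 ≤ Mh) (hP : ∀ μ, 1 ≤ P' μ)
    (u : BondIdx (domT hN D hk)) (hu : ¬ IsCT hN D D' hk u.1) :
    ∃ z : ↥(boxDom (N0 ℓ Mh k P')), blk ((ℓ + 1) ^ k) z.1 ∈ OmegaC D D' ∧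
      (geomT D).dist (β hN D hk u) (blkOf D.toDomains z) ≤ (ℓ : ℝ) + 3 := by
  classical
  obtain ⟨f, -, hf⟩ := Finset.exists_ne_zero_of_sum_ne_zero
    (show ∑ f, qk (k := k) u.1 f ≠ 0 by rw [sum_qk]; exact one_ne_zero)
  have hq : bondAvgIter (P := PV d ℓ m K hd hL) (u.1.1 : ℕ) (Pi.single f (1 : ℝ)) u.1.2 ≠ 0 := hf
  refine ⟨toBox hN f.src, witness_of_not_isCT hN D D' hk hk1 u hu f hq, ?_⟩
  have hx := iterBlockOf_of_bondAvgIter_single_ne_zero (P := PV d ℓ m K hd hL) (lvl_le_mK hN D hk u) hq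
  exact geomT_dist_ends_le hN D hk hk1 hRM hMh hP u hx

/-- … and the same for a surviving index bond of `{Ω′_j}`. [cite: Balaban1985BackgroundPropagators, Thm 3.14 p.427; Balaban1984PropagatorsII, (2.3) p.224] -/
theorem exists_witness_of_not_isCT' (hk1 : 1 ≤ k) (hRM : 2 ≤ R * Mh) (hMh : 1 ≤ Mh) (hP : ∀ μ, 1 ≤ P' μ)
    (v : BondIdx (domT hN D' hk)) (hv : ¬ IsCT hN D D' hk v.1) :
    ∃ z : ↥(boxDom (N0 ℓ Mh k P')), blk ((ℓ + 1) ^ k) z.1 ∈ OmegaC D D' ∧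
      (geomT D').dist (β hN D' hk v) (blkOf D'.toDomains z) ≤ (ℓ : ℝ) + 3 := by
  classical
  obtain ⟨f, -, hf⟩ := Finset.exists_ne_zero_of_sum_ne_zero
    (show ∑ f, qk (k := k) v.1 f ≠ 0 by rw [sum_qk]; exact one_ne_zero)
  have hq : bondAvgIter (P := PV d ℓ m K hd hL) (v.1.1 : ℕ) (Pi.single f (1 : ℝ)) v.1.2 ≠ 0 := hf
  refine ⟨toBox hN f.src, witness_of_not_isCT' hN D D' hk hk1 v hv f hq, ?_⟩
  have hx := iterBlockOf_of_bondAvgIter_single_ne_zero (P := PV d ℓ m K hd hL) (lvl_le_mK hN D' hk v) hq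
  exact geomT_dist_ends_le hN D' hk hk1 hRM hMh hP v hx

end Geometry

/-! ## §4  The estimate of one surviving term of the double sum -/

section Term

omit hd hL in
/-- the exponential bookkeeping of one surviving term: if `d(y, y′, Ω) ≤ d₁ + d₂ + d₃ + c` then
`e^{−δd₁}·e^{−½δd₂}·e^{−δd₃} ≤ e^{½δc}·e^{−½δ·d(y,y′,Ω)}·(e^{−¼δd₁}·e^{−¼δd₃})` (half of the outer rates kept for the (2.61) sums).
[cite: Balaban1985BackgroundPropagators, Thm 3.14 (3.154) p.427 («after adjusting a definition of δ₀»), bookkeeping] -/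
theorem exp_bookkeeping_c {δ c d₁ d₂ d₃ dΩ : ℝ} (hδ : 0 ≤ δ) (h₁ : 0 ≤ d₁) (h₃ : 0 ≤ d₃)
    (hΩ : dΩ ≤ d₁ + d₂ + d₃ + c) :
    Real.exp (-(δ * d₁)) * Real.exp (-(δ / 2 * d₂)) * Real.exp (-(δ * d₃))
      ≤ Real.exp (δ / 2 * c) * Real.exp (-(δ / 2 * dΩ)) * (Real.exp (-(δ / 4 * d₁)) * Real.exp (-(δ / 4 * d₃))) := by
  have e1 : Real.exp (-(δ * d₁)) * Real.exp (-(δ / 2 * d₂)) * Real.exp (-(δ * d₃))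
      = Real.exp (-(δ * d₁) + -(δ / 2 * d₂) + -(δ * d₃)) := by rw [Real.exp_add, Real.exp_add]
  have e2 : Real.exp (δ / 2 * c) * Real.exp (-(δ / 2 * dΩ)) * (Real.exp (-(δ / 4 * d₁)) * Real.exp (-(δ / 4 * d₃)))
      = Real.exp (δ / 2 * c + -(δ / 2 * dΩ) + (-(δ / 4 * d₁) + -(δ / 4 * d₃))) := by
    rw [Real.exp_add, Real.exp_add, Real.exp_add]
  rw [e1, e2, Real.exp_le_exp]
  nlinarith [mul_le_mul_of_nonneg_left hΩ hδ, mul_nonneg hδ h₁, mul_nonneg hδ h₃]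

omit hd hL in
/-- the three-factor product with the conjugation weights cancelling: `(SΛ_i⁻¹Λ_u⁻¹e₁)(AΛ_uΛ_ve₂)(SΛ_v⁻¹Λ_{i′}⁻¹e₃) = S²AΛ_i⁻¹Λ_{i′}⁻¹e₁e₂e₃`.
[cite: Balaban1984PropagatorsII, (2.81) p.237 («A_Λ = ΛAΛ»), bookkeeping] -/
theorem three_factor_le {x y z S A li lu lv li' e₁ e₂ e₃ : ℝ} (hy0 : 0 ≤ y) (hz0 : 0 ≤ z)
    (hlu : 0 < lu) (hlv : 0 < lv)
    (hx : x ≤ S * ((li)⁻¹ * (lu)⁻¹) * e₁) (hy : y ≤ A * (lu * lv) * e₂) (hz : z ≤ S * ((lv)⁻¹ * (li')⁻¹) * e₃)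
    (hx1 : 0 ≤ S * ((li)⁻¹ * (lu)⁻¹) * e₁) (hy1 : 0 ≤ A * (lu * lv) * e₂) :
    x * y * z ≤ S ^ 2 * A * ((li)⁻¹ * (li')⁻¹) * (e₁ * e₂ * e₃) := by
  calc x * y * z ≤ (S * ((li)⁻¹ * (lu)⁻¹) * e₁) * (A * (lu * lv) * e₂) * (S * ((lv)⁻¹ * (li')⁻¹) * e₃) :=
        mul_le_mul (mul_le_mul hx hy hy0 hx1) hz hz0 (mul_nonneg hx1 hy1)
    _ = S ^ 2 * A * ((li)⁻¹ * (li')⁻¹) * (e₁ * e₂ * e₃) * ((lu)⁻¹ * lu) * (lv * (lv)⁻¹) := by ring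
    _ = S ^ 2 * A * ((li)⁻¹ * (li')⁻¹) * (e₁ * e₂ * e₃) := by
        rw [inv_mul_cancel₀ hlu.ne', mul_inv_cancel₀ hlv.ne', mul_one, mul_one]

variable (hN : ∀ μ, N0 ℓ Mh k P' μ = (PV d ℓ m K hd hL).sitesPerDir 0) (D D' : TDomains d ℓ Mh k P' R) (hk : k ≤ m + K)
variable {cf : ℝ} (hcf : cf ≠ 0) {w : BondIdx (domT hN D hk) → ℝ} (hw : ∀ i, 0 < w i)
  {w' : BondIdx (domT hN D' hk) → ℝ} (hw' : ∀ i, 0 < w' i)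

include hcf in
/-- the common final shape of the three surviving cases: legs at rate `δ`, a middle factor `≤ A_mid·Λ_uΛ′_v·e^{−½δd₂}`, and the geometric
chain `d(βi, β′i′, Ω) ≤ ρ(i,u) + d₂ + ρ′(i′,v) + (2L + 9)` give the displayed bound. [cite: Balaban1985BackgroundPropagators, Thm 3.14 (3.154) p.427, bookkeeping] -/
theorem term_shape {S Amid K δ d₂ : ℝ} (hS : 0 ≤ S) (hA0 : 0 ≤ Amid) (hAle : Amid ≤ K) (hδ : 0 ≤ δ)
    (hMh : 1 ≤ Mh) (hP : ∀ μ, 1 ≤ P' μ)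
    (i u : BondIdx (domT hN D hk)) (i' v : BondIdx (domT hN D' hk)) {x y z : ℝ} (hy0 : 0 ≤ y) (hz0 : 0 ≤ z)
    (hx : x ≤ S * ((lam hN D hk cf i)⁻¹ * (lam hN D hk cf u)⁻¹) * Real.exp (-(δ * rho hN D hk i u)))
    (hy : y ≤ Amid * (lam hN D hk cf u * lam hN D' hk cf v) * Real.exp (-(δ / 2 * d₂)))
    (hz : z ≤ S * ((lam hN D' hk cf v)⁻¹ * (lam hN D' hk cf i')⁻¹) * Real.exp (-(δ * rho hN D' hk i' v)))
    (hΩ : dOmega D D' (β hN D hk i).1.2 (β hN D' hk i').1.2 ≤ rho hN D hk i u + d₂ + rho hN D' hk i' v + (2 * (ℓ : ℝ) + 11)) :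
    x * y * z ≤ S ^ 2 * K * Real.exp (δ / 2 * (2 * (ℓ : ℝ) + 11))
        * ((lam hN D hk cf i)⁻¹ * (lam hN D' hk cf i')⁻¹)
        * Real.exp (-(δ / 2 * dOmega D D' (β hN D hk i).1.2 (β hN D' hk i').1.2))
        * (Real.exp (-(δ / 4 * rho hN D hk i u)) * Real.exp (-(δ / 4 * rho hN D' hk i' v))) := by
  have hρ := B6Prop27KLevelV1.rho_isPseudoDist hN D hk hMh hP
  have hρ' := B6Prop27KLevelV1.rho_isPseudoDist hN D' hk hMh hP
  have hli := lam_pos hN D hk hcf i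
  have hli' := lam_pos hN D' hk hcf i'
  have hlu := lam_pos hN D hk hcf u
  have hlv := lam_pos hN D' hk hcf v
  have h3 := three_factor_le hy0 hz0 hlu hlv hx hy hz (by positivity) (by positivity)
  have hbook := exp_bookkeeping_c (c := 2 * (ℓ : ℝ) + 11) hδ (hρ.nonneg i u) (hρ'.nonneg i' v) hΩ
  have hF : 0 ≤ S ^ 2 * Amid * ((lam hN D hk cf i)⁻¹ * (lam hN D' hk cf i')⁻¹) := by positivity
  refine h3.trans ((mul_le_mul_of_nonneg_left hbook hF).trans ?_)
  have hZ : 0 ≤ Real.exp (δ / 2 * (2 * (ℓ : ℝ) + 11))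
      * Real.exp (-(δ / 2 * dOmega D D' (β hN D hk i).1.2 (β hN D' hk i').1.2))
      * (Real.exp (-(δ / 4 * rho hN D hk i u)) * Real.exp (-(δ / 4 * rho hN D' hk i' v))) := by positivity
  have hmono : S ^ 2 * Amid * ((lam hN D hk cf i)⁻¹ * (lam hN D' hk cf i')⁻¹)
      ≤ S ^ 2 * K * ((lam hN D hk cf i)⁻¹ * (lam hN D' hk cf i')⁻¹) :=
    mul_le_mul_of_nonneg_right (mul_le_mul_of_nonneg_left hAle (sq_nonneg _)) (by positivity)
  calc S ^ 2 * Amid * ((lam hN D hk cf i)⁻¹ * (lam hN D' hk cf i')⁻¹)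
        * (Real.exp (δ / 2 * (2 * (ℓ : ℝ) + 11))
          * Real.exp (-(δ / 2 * dOmega D D' (β hN D hk i).1.2 (β hN D' hk i').1.2))
          * (Real.exp (-(δ / 4 * rho hN D hk i u)) * Real.exp (-(δ / 4 * rho hN D' hk i' v))))
      ≤ S ^ 2 * K * ((lam hN D hk cf i)⁻¹ * (lam hN D' hk cf i')⁻¹)
        * (Real.exp (δ / 2 * (2 * (ℓ : ℝ) + 11))
          * Real.exp (-(δ / 2 * dOmega D D' (β hN D hk i).1.2 (β hN D' hk i').1.2))
          * (Real.exp (-(δ / 4 * rho hN D hk i u)) * Real.exp (-(δ / 4 * rho hN D' hk i' v)))) :=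
        mul_le_mul_of_nonneg_right hmono hZ
    _ = _ := by ring

/-- **ONE TERM OF THE DOUBLE SUM.**  HYPOTHESES (all at one rate `δ`, in the conjugated flat currency `Λ`): the (2.149) bounds of
`(QGQ*)⁻¹[D]`, `(QGQ*)⁻¹[D′]` (`|(QGQ*)⁻¹(a,b)| ≤ S·Λ_a⁻¹Λ_b⁻¹e^{−δρ(a,b)}`), the (2.142) bounds of `X = QGQ*`, `X′` in the symmetric form
`|X(a,b)| ≤ A′Λ_aΛ_be^{−δρ(a,b)}`, and the Theorem-3.14 bound of `X′ − X` on common top pairs (`≤ C_Δ·Λ_uΛ′_v·e^{−δd(β u, β′ v, Ω)}`, file Q1).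
CONCLUSION: for common top `i ∈ 𝔅[D]`, `i′ ∈ 𝔅[D′]` and ANY `u ∈ 𝔅[D]`, `v ∈ 𝔅[D′]`:
`|(QGQ*)⁻¹(i,u)|·|M(u,v)|·|(QGQ*)⁻¹′(v,i′)| ≤ S²(C_Δ + A′)e^{½δ(2L+9)}·Λ_i⁻¹Λ′_{i′}⁻¹·e^{−½δd(β i, β′ i′, Ω)}·e^{−¼δρ(i,u)}·e^{−¼δρ′(i′,v)}`:
if both `u`, `v` are common top the middle factor is the file-Q1 difference; if exactly one is, the other index bond charges `Ωᶜ`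
(`exists_witness_of_not_isCT`) and the (3.154) factor is read off the chain `i → u → v → i′` through the witness (the carrier blocks of
twins being `k`-neighbours, `tdistK_twin_le`); if neither is, the term vanishes; the conjugation weights `Λ_u`, `Λ′_v` cancel exactly.
[cite: Balaban1985BackgroundPropagators, Thm 3.14 (3.154) pp.426–427; Balaban1984PropagatorsII, (2.142) p.248, Prop. 2.7 (2.149) p.249] -/
theorem term_le (hk1 : 1 ≤ k) (hRM : 2 ≤ R * Mh) (hMh : 1 ≤ Mh) (hP : ∀ μ, 1 ≤ P' μ) {S A' CΔ δ : ℝ}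
    (hS : 0 ≤ S) (hA' : 0 ≤ A') (hCΔ : 0 ≤ CΔ) (hδ : 0 ≤ δ)
    (hE : ∀ a b : BondIdx (domT hN D hk), |ent hN D hk (EE (domT hN D hk) hcf hw) a b|
      ≤ S * ((lam hN D hk cf a)⁻¹ * (lam hN D hk cf b)⁻¹) * Real.exp (-(δ * rho hN D hk a b)))
    (hE' : ∀ a b : BondIdx (domT hN D' hk), |ent hN D' hk (EE (domT hN D' hk) hcf hw') a b|
      ≤ S * ((lam hN D' hk cf a)⁻¹ * (lam hN D' hk cf b)⁻¹) * Real.exp (-(δ * rho hN D' hk a b)))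
    (hXf : ∀ a b : BondIdx (domT hN D hk), |X hN D hk hcf hw a b|
      ≤ A' * (lam hN D hk cf a * lam hN D hk cf b) * Real.exp (-(δ * rho hN D hk a b)))
    (hXf' : ∀ a b : BondIdx (domT hN D' hk), |X hN D' hk hcf hw' a b|
      ≤ A' * (lam hN D' hk cf a * lam hN D' hk cf b) * Real.exp (-(δ * rho hN D' hk a b)))
    (hΔ : ∀ (u : BondIdx (domT hN D hk)) (hu : IsCT hN D D' hk u.1) (v : BondIdx (domT hN D' hk)) (hv : IsCT hN D D' hk v.1),
      |X hN D' hk hcf hw' ⟨u.1, hu.2.2⟩ v - X hN D hk hcf hw u ⟨v.1, hv.2.1⟩|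
        ≤ CΔ * (lam hN D hk cf u * lam hN D' hk cf v)
          * Real.exp (-(δ * dOmega D D' (β hN D hk u).1.2 (β hN D' hk v).1.2)))
    {i : BondIdx (domT hN D hk)} (hi : IsCT hN D D' hk i.1) {i' : BondIdx (domT hN D' hk)} (hi' : IsCT hN D D' hk i'.1)
    (u : BondIdx (domT hN D hk)) (v : BondIdx (domT hN D' hk)) :
    |ent hN D hk (EE (domT hN D hk) hcf hw) i u| * |transKer hN D D' hk hcf hw hw' u v|
        * |ent hN D' hk (EE (domT hN D' hk) hcf hw') v i'|
      ≤ S ^ 2 * (CΔ + A') * Real.exp (δ / 2 * (2 * (ℓ : ℝ) + 11))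
          * ((lam hN D hk cf i)⁻¹ * (lam hN D' hk cf i')⁻¹)
          * Real.exp (-(δ / 2 * dOmega D D' (β hN D hk i).1.2 (β hN D' hk i').1.2))
          * (Real.exp (-(δ / 4 * rho hN D hk i u)) * Real.exp (-(δ / 4 * rho hN D' hk i' v))) := by
  classical
  have hρ := B6Prop27KLevelV1.rho_isPseudoDist hN D hk hMh hP
  have hρ' := B6Prop27KLevelV1.rho_isPseudoDist hN D' hk hMh hP
  have hdT := B6Prop23MultiLevelTorus.isPseudoDist_distT D hMh hP
  have hdT' := B6Prop23MultiLevelTorus.isPseudoDist_distT D' hMh hP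
  have hΩ0 : ∀ β₁ β₂, 0 ≤ dOmega D D' β₁ β₂ := dOmega_nonneg D D'
  have hlu := lam_pos hN D hk hcf u
  have hlv := lam_pos hN D' hk hcf v
  -- the two outer legs
  have hEi := hE i u
  have hEv := hE' v i'
  have hsymm' : rho hN D' hk v i' = rho hN D' hk i' v := hρ'.symm v i'
  rw [hsymm'] at hEv
  by_cases hu : IsCT hN D D' hk u.1 <;> by_cases hv : IsCT hN D D' hk v.1
  · -- both common top: the file-Q1 difference in the middle
    have hM : |transKer hN D D' hk hcf hw hw' u v|
        ≤ CΔ * (lam hN D hk cf u * lam hN D' hk cf v)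
          * Real.exp (-(δ / 2 * (2 * dOmega D D' (β hN D hk u).1.2 (β hN D' hk v).1.2))) := by
      unfold transKer; rw [dif_pos hu, dif_pos hv]
      refine (hΔ u hu v hv).trans (le_of_eq ?_)
      congr 2; ring
    -- geometry: `d(βi,β′i′,Ω) ≤ ρ(i,u) + 2·d(βu,β′v,Ω) + ρ′(i′,v)`
    have hΩ : dOmega D D' (β hN D hk i).1.2 (β hN D' hk i').1.2
        ≤ rho hN D hk i u + 2 * dOmega D D' (β hN D hk u).1.2 (β hN D' hk v).1.2 + rho hN D' hk i' v + (2 * (ℓ : ℝ) + 11) := by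
      have h1 := dOmega_le_tdistK_add D D' (β hN D hk i).1.2 (β hN D hk u).1.2 (β hN D' hk i').1.2
      have h2 := dOmega_le_add_tdistK D D' (β hN D hk u).1.2 (β hN D' hk v).1.2 (β hN D' hk i').1.2
      have h3 := tdistK_le_rho_of_top hN hk D hMh hP hk1 i u hi.1 hu.1
      have h4 := tdistK_le_rho_of_top hN hk D' hMh hP hk1 v i' hv.1 hi'.1
      have h5 := hΩ0 (β hN D hk u).1.2 (β hN D' hk v).1.2
      rw [hsymm'] at h4
      have h6 : (0 : ℝ) ≤ 2 * (ℓ : ℝ) + 11 := by positivity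
      linarith
    exact term_shape hN D D' hk hcf hS hCΔ (le_add_of_nonneg_right hA') hδ hMh hP i u i' v (abs_nonneg _) (abs_nonneg _)
      hEi hM hEv hΩ
  · -- `u` common top, `v` not: the middle factor is `X′(ũ, v)`, `v` charges `Ωᶜ`
    have hM : |transKer hN D D' hk hcf hw hw' u v|
        ≤ A' * (lam hN D hk cf u * lam hN D' hk cf v) * Real.exp (-(δ / 2 * rho hN D' hk ⟨u.1, hu.2.2⟩ v)) := by
      unfold transKer; rw [dif_pos hu, dif_neg hv, sub_zero]
      refine (hXf' ⟨u.1, hu.2.2⟩ v).trans ?_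
      rw [lam_twin hN D D' hk cf u hu]
      refine mul_le_mul_of_nonneg_left (Real.exp_le_exp.2 ?_) (mul_nonneg hA' (mul_pos hlu hlv).le)
      nlinarith [hρ'.nonneg ⟨u.1, hu.2.2⟩ v]
    -- the witness in the tube of `v` and the (3.154) factor along `i → u ~ ũ → v ∋ z → i′`
    obtain ⟨z, hzΩ, hz⟩ := exists_witness_of_not_isCT' hN D D' hk hk1 hRM hMh hP v hv
    have hΩ : dOmega D D' (β hN D hk i).1.2 (β hN D' hk i').1.2
        ≤ rho hN D hk i u + rho hN D' hk ⟨u.1, hu.2.2⟩ v + rho hN D' hk i' v + (2 * (ℓ : ℝ) + 11) := by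
      have h0 := dOmega_le D D' (β := (β hN D hk i).1.2) (β' := (β hN D' hk i').1.2) hzΩ
      have h1 := tdistK_triangle (ℓ := ℓ) (Mh := Mh) (k := k) (P := P') (β hN D hk i).1.2 (β hN D hk u).1.2 (blk ((ℓ + 1) ^ k) z.1)
      have h2 := tdistK_triangle (ℓ := ℓ) (Mh := Mh) (k := k) (P := P') (β hN D hk u).1.2 (β hN D' hk ⟨u.1, hu.2.2⟩).1.2
        (blk ((ℓ + 1) ^ k) z.1)
      have h3 := tdistK_le_rho_of_top hN hk D hMh hP hk1 i u hi.1 hu.1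
      have h4 := tdistK_twin_le hN D D' hk u hu hk1
      have hut : (β hN D' hk ⟨u.1, hu.2.2⟩).1.1 = k := (beta_level hN D' hk hk1 _).trans hu.1
      have hit : (β hN D' hk i').1.1 = k := (beta_level hN D' hk hk1 _).trans hi'.1
      have h5 := tdistK_blk_le_of_top D' hMh hP z hut
      have h6 := tdistK_blk_le_of_top D' hMh hP z hit
      rw [tdistK_comm] at h5
      have h7 := hdT'.triangle (blkOf D'.toDomains z) (β hN D' hk v) (β hN D' hk ⟨u.1, hu.2.2⟩)
      have h8 := hdT'.triangle (blkOf D'.toDomains z) (β hN D' hk v) (β hN D' hk i')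
      have h9 : (geomT D').dist (blkOf D'.toDomains z) (β hN D' hk v) ≤ (ℓ : ℝ) + 3 := by rw [hdT'.symm]; exact hz
      have h10 : (geomT D').dist (β hN D' hk v) (β hN D' hk ⟨u.1, hu.2.2⟩) = rho hN D' hk ⟨u.1, hu.2.2⟩ v := hρ'.symm v _
      have h11 : (geomT D').dist (β hN D' hk v) (β hN D' hk i') = rho hN D' hk i' v := hρ'.symm v i'
      linarith
    exact term_shape hN D D' hk hcf hS hA' (le_add_of_nonneg_left hCΔ) hδ hMh hP i u i' v (abs_nonneg _) (abs_nonneg _)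
      hEi hM hEv hΩ
  · -- `u` not common top, `v` common top: the middle factor is `X(u, v_D)`, `u` charges `Ωᶜ`
    have hM : |transKer hN D D' hk hcf hw hw' u v|
        ≤ A' * (lam hN D hk cf u * lam hN D' hk cf v) * Real.exp (-(δ / 2 * rho hN D hk u ⟨v.1, hv.2.1⟩)) := by
      unfold transKer; rw [dif_neg hu, dif_pos hv, zero_sub, abs_neg]
      refine (hXf u ⟨v.1, hv.2.1⟩).trans ?_
      rw [lam_twin' hN D D' hk cf v hv]
      refine mul_le_mul_of_nonneg_left (Real.exp_le_exp.2 ?_) (mul_nonneg hA' (mul_pos hlu hlv).le)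
      nlinarith [hρ.nonneg u ⟨v.1, hv.2.1⟩]
    obtain ⟨z, hzΩ, hz⟩ := exists_witness_of_not_isCT hN D D' hk hk1 hRM hMh hP u hu
    have hΩ : dOmega D D' (β hN D hk i).1.2 (β hN D' hk i').1.2
        ≤ rho hN D hk i u + rho hN D hk u ⟨v.1, hv.2.1⟩ + rho hN D' hk i' v + (2 * (ℓ : ℝ) + 11) := by
      have h0 := dOmega_le D D' (β := (β hN D hk i).1.2) (β' := (β hN D' hk i').1.2) hzΩ
      have h1 := tdistK_triangle (ℓ := ℓ) (Mh := Mh) (k := k) (P := P') (blk ((ℓ + 1) ^ k) z.1) (β hN D hk ⟨v.1, hv.2.1⟩).1.2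
        (β hN D' hk i').1.2
      have h2 := tdistK_triangle (ℓ := ℓ) (Mh := Mh) (k := k) (P := P') (β hN D hk ⟨v.1, hv.2.1⟩).1.2 (β hN D' hk v).1.2
        (β hN D' hk i').1.2
      have h3 := tdistK_le_rho_of_top hN hk D' hMh hP hk1 v i' hv.1 hi'.1
      rw [hsymm'] at h3
      have h4 := tdistK_twin_le' hN D D' hk v hv hk1
      have hit : (β hN D hk i).1.1 = k := (beta_level hN D hk hk1 _).trans hi.1
      have hvt : (β hN D hk ⟨v.1, hv.2.1⟩).1.1 = k := (beta_level hN D hk hk1 _).trans hv.1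
      have h5 := tdistK_blk_le_of_top D hMh hP z hit
      have h6 := tdistK_blk_le_of_top D hMh hP z hvt
      rw [tdistK_comm] at h5
      have h7 := hdT.triangle (blkOf D.toDomains z) (β hN D hk u) (β hN D hk i)
      have h8 := hdT.triangle (blkOf D.toDomains z) (β hN D hk u) (β hN D hk ⟨v.1, hv.2.1⟩)
      have h9 : (geomT D).dist (blkOf D.toDomains z) (β hN D hk u) ≤ (ℓ : ℝ) + 3 := by rw [hdT.symm]; exact hz
      have h10 : (geomT D).dist (β hN D hk u) (β hN D hk i) = rho hN D hk i u := hρ.symm u i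
      have h11 : (geomT D).dist (β hN D hk u) (β hN D hk ⟨v.1, hv.2.1⟩) = rho hN D hk u ⟨v.1, hv.2.1⟩ := rfl
      linarith
    exact term_shape hN D D' hk hcf hS hA' (le_add_of_nonneg_left hCΔ) hδ hMh hP i u i' v (abs_nonneg _) (abs_nonneg _)
      hEi hM hEv hΩ
  · -- neither: the term vanishes
    have hM : transKer hN D D' hk hcf hw hw' u v = 0 := by unfold transKer; rw [dif_neg hu, dif_neg hv, sub_zero]
    rw [hM, abs_zero, mul_zero, zero_mul]
    have := lam_pos hN D hk hcf i
    have := lam_pos hN D' hk hcf i'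
    positivity

end Term

/-! ## §5  The double sum: (2.61) twice on the index bonds of the two families -/

section Sum

variable (hN : ∀ μ, N0 ℓ Mh k P' μ = (PV d ℓ m K hd hL).sitesPerDir 0) (D D' : TDomains d ℓ Mh k P' R) (hk : k ≤ m + K)
variable {cf : ℝ} (hcf : cf ≠ 0) {w : BondIdx (domT hN D hk) → ℝ} (hw : ∀ i, 0 < w i)
  {w' : BondIdx (domT hN D' hk) → ℝ} (hw' : ∀ i, 0 < w' i)

omit hd hL in
/-- `Σ_u Σ_v C·(a_u·b_v) = C·(Σ_u a_u)(Σ_v b_v)`. [folklore] -/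
private theorem sum_sum_mul_eq {ι κ : Type*} (s : Finset ι) (t : Finset κ) (C : ℝ) (a : ι → ℝ) (b : κ → ℝ) :
    ∑ u ∈ s, ∑ v ∈ t, C * (a u * b v) = C * ((∑ u ∈ s, a u) * (∑ v ∈ t, b v)) := by
  rw [Finset.sum_mul_sum, Finset.mul_sum]
  refine Finset.sum_congr rfl fun u _ => ?_
  rw [Finset.mul_sum]

/-- **THE TRANSFER BOUND**: under the hypotheses of `term_le` and the Lemma-2.1 profiles of the two index-bond lattices at rate `¼δ`
(`Σ_u e^{−¼δρ(a,u)} ≤ K_s`, `Σ_v e^{−¼δρ′(b,v)} ≤ K_s′`), for common top `i ∈ 𝔅[D]`, `i′ ∈ 𝔅[D′]`: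
`|(QGQ*)⁻¹[D](i, i′) − (QGQ*)⁻¹[D′](i, i′)| ≤ S²(C_Δ + A′)e^{½δ(2L+9)}K_sK_s′·Λ_i⁻¹Λ′_{i′}⁻¹·e^{−½δd(β i, β′ i′, Ω)}`.
[cite: Balaban1985BackgroundPropagators, Thm 3.14 (3.154) p.427; Balaban1984PropagatorsII, Lemma 2.1 (2.61) p.234, Prop. 2.7 p.249] -/
theorem transfer_bound (hk1 : 1 ≤ k) (hRM : 2 ≤ R * Mh) (hMh : 1 ≤ Mh) (hP : ∀ μ, 1 ≤ P' μ) {S A' CΔ δ Ks Ks' : ℝ}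
    (hS : 0 ≤ S) (hA' : 0 ≤ A') (hCΔ : 0 ≤ CΔ) (hδ : 0 ≤ δ) (hKs : 0 ≤ Ks)
    (hE : ∀ a b : BondIdx (domT hN D hk), |ent hN D hk (EE (domT hN D hk) hcf hw) a b|
      ≤ S * ((lam hN D hk cf a)⁻¹ * (lam hN D hk cf b)⁻¹) * Real.exp (-(δ * rho hN D hk a b)))
    (hE' : ∀ a b : BondIdx (domT hN D' hk), |ent hN D' hk (EE (domT hN D' hk) hcf hw') a b|
      ≤ S * ((lam hN D' hk cf a)⁻¹ * (lam hN D' hk cf b)⁻¹) * Real.exp (-(δ * rho hN D' hk a b)))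
    (hXf : ∀ a b : BondIdx (domT hN D hk), |X hN D hk hcf hw a b|
      ≤ A' * (lam hN D hk cf a * lam hN D hk cf b) * Real.exp (-(δ * rho hN D hk a b)))
    (hXf' : ∀ a b : BondIdx (domT hN D' hk), |X hN D' hk hcf hw' a b|
      ≤ A' * (lam hN D' hk cf a * lam hN D' hk cf b) * Real.exp (-(δ * rho hN D' hk a b)))
    (hΔ : ∀ (u : BondIdx (domT hN D hk)) (hu : IsCT hN D D' hk u.1) (v : BondIdx (domT hN D' hk)) (hv : IsCT hN D D' hk v.1),
      |X hN D' hk hcf hw' ⟨u.1, hu.2.2⟩ v - X hN D hk hcf hw u ⟨v.1, hv.2.1⟩|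
        ≤ CΔ * (lam hN D hk cf u * lam hN D' hk cf v)
          * Real.exp (-(δ * dOmega D D' (β hN D hk u).1.2 (β hN D' hk v).1.2)))
    (hSum : ∀ a : BondIdx (domT hN D hk), ∑ u, Real.exp (-(δ / 4 * rho hN D hk a u)) ≤ Ks)
    (hSum' : ∀ b : BondIdx (domT hN D' hk), ∑ v, Real.exp (-(δ / 4 * rho hN D' hk b v)) ≤ Ks')
    {i : BondIdx (domT hN D hk)} (hi : IsCT hN D D' hk i.1) {i' : BondIdx (domT hN D' hk)} (hi' : IsCT hN D D' hk i'.1) :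
    |ent hN D hk (EE (domT hN D hk) hcf hw) i ⟨i'.1, hi'.2.1⟩ - ent hN D' hk (EE (domT hN D' hk) hcf hw') ⟨i.1, hi.2.2⟩ i'|
      ≤ S ^ 2 * (CΔ + A') * Real.exp (δ / 2 * (2 * (ℓ : ℝ) + 11)) * (Ks * Ks')
          * ((lam hN D hk cf i)⁻¹ * (lam hN D' hk cf i')⁻¹)
          * Real.exp (-(δ / 2 * dOmega D D' (β hN D hk i).1.2 (β hN D' hk i').1.2)) := by
  classical
  rw [entEE_sub_eq hN D D' hk hcf hw hw' i hi i' hi']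
  have hli := lam_pos hN D hk hcf i
  have hli' := lam_pos hN D' hk hcf i'
  set C : ℝ := S ^ 2 * (CΔ + A') * Real.exp (δ / 2 * (2 * (ℓ : ℝ) + 11))
      * ((lam hN D hk cf i)⁻¹ * (lam hN D' hk cf i')⁻¹)
      * Real.exp (-(δ / 2 * dOmega D D' (β hN D hk i).1.2 (β hN D' hk i').1.2)) with hC
  have hC0 : 0 ≤ C := by positivity
  have hterm : ∀ u v, |ent hN D hk (EE (domT hN D hk) hcf hw) i u * transKer hN D D' hk hcf hw hw' u v
        * ent hN D' hk (EE (domT hN D' hk) hcf hw') v i'|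
      ≤ C * (Real.exp (-(δ / 4 * rho hN D hk i u)) * Real.exp (-(δ / 4 * rho hN D' hk i' v))) := by
    intro u v
    rw [abs_mul, abs_mul]
    exact term_le hN D D' hk hcf hw hw' hk1 hRM hMh hP hS hA' hCΔ hδ hE hE' hXf hXf' hΔ hi hi' u v
  calc |∑ u, ∑ v, ent hN D hk (EE (domT hN D hk) hcf hw) i u * transKer hN D D' hk hcf hw hw' u v
          * ent hN D' hk (EE (domT hN D' hk) hcf hw') v i'|
      ≤ ∑ u, |∑ v, ent hN D hk (EE (domT hN D hk) hcf hw) i u * transKer hN D D' hk hcf hw hw' u v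
          * ent hN D' hk (EE (domT hN D' hk) hcf hw') v i'| := Finset.abs_sum_le_sum_abs _ _
    _ ≤ ∑ u, ∑ v, |ent hN D hk (EE (domT hN D hk) hcf hw) i u * transKer hN D D' hk hcf hw hw' u v
          * ent hN D' hk (EE (domT hN D' hk) hcf hw') v i'| := Finset.sum_le_sum fun u _ => Finset.abs_sum_le_sum_abs _ _
    _ ≤ ∑ u, ∑ v, C * (Real.exp (-(δ / 4 * rho hN D hk i u)) * Real.exp (-(δ / 4 * rho hN D' hk i' v))) :=
        Finset.sum_le_sum fun u _ => Finset.sum_le_sum fun v _ => hterm u v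
    _ = C * ((∑ u, Real.exp (-(δ / 4 * rho hN D hk i u))) * (∑ v, Real.exp (-(δ / 4 * rho hN D' hk i' v)))) :=
        sum_sum_mul_eq _ _ C _ _
    _ ≤ C * (Ks * Ks') := by
        refine mul_le_mul_of_nonneg_left ?_ hC0
        exact mul_le_mul (hSum i) (hSum' i') (Finset.sum_nonneg fun v _ => (Real.exp_pos _).le) hKs
    _ = _ := by rw [hC]; ring

/-! ## §6  The combination with the trivial bound: the (3.154) factor AND the (2.149) decay -/

/-- **THEOREM 3.14 AT `U = 1` FOR `(QGQ*)⁻¹`, HYPOTHESIS-LEVEL**: under the hypotheses of `transfer_bound`, for common top index bonds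
`i ∈ 𝔅[D]`, `i′ ∈ 𝔅[D′]` (read in both lattices through their twins):
`|⟪e_i, (QGQ*)⁻¹[D]e_{i′}⟫ − ⟪e_i, (QGQ*)⁻¹[D′]e_{i′}⟫| ≤ √(2S)·√(S²(C_Δ+A′)e^{½δ(2L+9)}K_sK_s′)·Λ_i⁻¹Λ′_{i′}⁻¹·e^{−½δ·min(ρ(i,i′),ρ′(i,i′))}·e^{−¼δ·d(β i, β′ i′, Ω)}`
— the geometric mean of the plain (2.149) decay of each inverse (`2SΛ⁻¹Λ⁻¹e^{−δ min ρ}`) and the transfer bound of §5: print's «their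
difference satisfies all the inequalities characteristic for operators of the considered type, with the additional factor exp(−δ₀d(y,y′,Ω))».
[cite: Balaban1985BackgroundPropagators, Thm 3.14 (3.154) pp.426–427; Balaban1984PropagatorsII, Prop. 2.7 (2.149) p.249] -/
theorem thm314_QGQinv_of_hyps (hk1 : 1 ≤ k) (hRM : 2 ≤ R * Mh) (hMh : 1 ≤ Mh) (hP : ∀ μ, 1 ≤ P' μ) {S A' CΔ δ Ks Ks' : ℝ}
    (hS : 0 ≤ S) (hA' : 0 ≤ A') (hCΔ : 0 ≤ CΔ) (hδ : 0 ≤ δ) (hKs : 0 ≤ Ks) (hKs' : 0 ≤ Ks')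
    (hE : ∀ a b : BondIdx (domT hN D hk), |ent hN D hk (EE (domT hN D hk) hcf hw) a b|
      ≤ S * ((lam hN D hk cf a)⁻¹ * (lam hN D hk cf b)⁻¹) * Real.exp (-(δ * rho hN D hk a b)))
    (hE' : ∀ a b : BondIdx (domT hN D' hk), |ent hN D' hk (EE (domT hN D' hk) hcf hw') a b|
      ≤ S * ((lam hN D' hk cf a)⁻¹ * (lam hN D' hk cf b)⁻¹) * Real.exp (-(δ * rho hN D' hk a b)))
    (hXf : ∀ a b : BondIdx (domT hN D hk), |X hN D hk hcf hw a b|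
      ≤ A' * (lam hN D hk cf a * lam hN D hk cf b) * Real.exp (-(δ * rho hN D hk a b)))
    (hXf' : ∀ a b : BondIdx (domT hN D' hk), |X hN D' hk hcf hw' a b|
      ≤ A' * (lam hN D' hk cf a * lam hN D' hk cf b) * Real.exp (-(δ * rho hN D' hk a b)))
    (hΔ : ∀ (u : BondIdx (domT hN D hk)) (hu : IsCT hN D D' hk u.1) (v : BondIdx (domT hN D' hk)) (hv : IsCT hN D D' hk v.1),
      |X hN D' hk hcf hw' ⟨u.1, hu.2.2⟩ v - X hN D hk hcf hw u ⟨v.1, hv.2.1⟩|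
        ≤ CΔ * (lam hN D hk cf u * lam hN D' hk cf v)
          * Real.exp (-(δ * dOmega D D' (β hN D hk u).1.2 (β hN D' hk v).1.2)))
    (hSum : ∀ a : BondIdx (domT hN D hk), ∑ u, Real.exp (-(δ / 4 * rho hN D hk a u)) ≤ Ks)
    (hSum' : ∀ b : BondIdx (domT hN D' hk), ∑ v, Real.exp (-(δ / 4 * rho hN D' hk b v)) ≤ Ks')
    {i : BondIdx (domT hN D hk)} (hi : IsCT hN D D' hk i.1) {i' : BondIdx (domT hN D' hk)} (hi' : IsCT hN D D' hk i'.1) :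
    |⟪EuclideanSpace.single i (1 : ℝ), EE (domT hN D hk) hcf hw (EuclideanSpace.single (⟨i'.1, hi'.2.1⟩ : BondIdx (domT hN D hk)) (1 : ℝ))⟫_ℝ
      - ⟪EuclideanSpace.single (⟨i.1, hi.2.2⟩ : BondIdx (domT hN D' hk)) (1 : ℝ), EE (domT hN D' hk) hcf hw' (EuclideanSpace.single i' (1 : ℝ))⟫_ℝ|
      ≤ Real.sqrt (2 * S) * Real.sqrt (S ^ 2 * (CΔ + A') * Real.exp (δ / 2 * (2 * (ℓ : ℝ) + 11)) * (Ks * Ks'))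
          * ((lam hN D hk cf i)⁻¹ * (lam hN D' hk cf i')⁻¹)
          * Real.exp (-(1 / 2 * δ * min (rho hN D hk i ⟨i'.1, hi'.2.1⟩) (rho hN D' hk ⟨i.1, hi.2.2⟩ i')))
          * Real.exp (-(1 / 4 * δ * dOmega D D' (β hN D hk i).1.2 (β hN D' hk i').1.2)) := by
  rw [inner_EE_eq_ent, inner_EE_eq_ent]
  have hli := lam_pos hN D hk hcf i
  have hli' := lam_pos hN D' hk hcf i'
  -- the transfer bound of §5 in the shape of `combined_bound`
  have h2 := transfer_bound hN D D' hk hcf hw hw' hk1 hRM hMh hP hS hA' hCΔ hδ hKs hE hE' hXf hXf' hΔ hSum hSum' hi hi'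
  have h2' : |ent hN D hk (EE (domT hN D hk) hcf hw) i ⟨i'.1, hi'.2.1⟩ - ent hN D' hk (EE (domT hN D' hk) hcf hw') ⟨i.1, hi.2.2⟩ i'|
      ≤ S ^ 2 * (CΔ + A') * Real.exp (δ / 2 * (2 * (ℓ : ℝ) + 11)) * (Ks * Ks')
          * ((lam hN D hk cf i)⁻¹ * (lam hN D' hk cf i')⁻¹)
          * Real.exp (-(1 / 2 * δ * dOmega D D' (β hN D hk i).1.2 (β hN D' hk i').1.2)) := by
    refine h2.trans (le_of_eq ?_)
    congr 2; ring
  -- the trivial bound: the two (2.149) decays added, twins have equal weights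
  have h1 : |ent hN D hk (EE (domT hN D hk) hcf hw) i ⟨i'.1, hi'.2.1⟩ - ent hN D' hk (EE (domT hN D' hk) hcf hw') ⟨i.1, hi.2.2⟩ i'|
      ≤ 2 * S * ((lam hN D hk cf i)⁻¹ * (lam hN D' hk cf i')⁻¹)
          * Real.exp (-(δ * min (rho hN D hk i ⟨i'.1, hi'.2.1⟩) (rho hN D' hk ⟨i.1, hi.2.2⟩ i'))) := by
    have ha := hE i ⟨i'.1, hi'.2.1⟩
    have hb := hE' ⟨i.1, hi.2.2⟩ i'
    rw [lam_twin' hN D D' hk cf i' hi'] at ha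
    rw [lam_twin hN D D' hk cf i hi] at hb
    have hF : 0 ≤ S * ((lam hN D hk cf i)⁻¹ * (lam hN D' hk cf i')⁻¹) := by positivity
    have hea : Real.exp (-(δ * rho hN D hk i ⟨i'.1, hi'.2.1⟩))
        ≤ Real.exp (-(δ * min (rho hN D hk i ⟨i'.1, hi'.2.1⟩) (rho hN D' hk ⟨i.1, hi.2.2⟩ i'))) :=
      Real.exp_le_exp.2 (by nlinarith [min_le_left (rho hN D hk i ⟨i'.1, hi'.2.1⟩) (rho hN D' hk ⟨i.1, hi.2.2⟩ i')])
    have heb : Real.exp (-(δ * rho hN D' hk ⟨i.1, hi.2.2⟩ i'))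
        ≤ Real.exp (-(δ * min (rho hN D hk i ⟨i'.1, hi'.2.1⟩) (rho hN D' hk ⟨i.1, hi.2.2⟩ i'))) :=
      Real.exp_le_exp.2 (by nlinarith [min_le_right (rho hN D hk i ⟨i'.1, hi'.2.1⟩) (rho hN D' hk ⟨i.1, hi.2.2⟩ i')])
    calc |ent hN D hk (EE (domT hN D hk) hcf hw) i ⟨i'.1, hi'.2.1⟩ - ent hN D' hk (EE (domT hN D' hk) hcf hw') ⟨i.1, hi.2.2⟩ i'|
        ≤ |ent hN D hk (EE (domT hN D hk) hcf hw) i ⟨i'.1, hi'.2.1⟩| + |ent hN D' hk (EE (domT hN D' hk) hcf hw') ⟨i.1, hi.2.2⟩ i'| :=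
          abs_sub _ _
      _ ≤ S * ((lam hN D hk cf i)⁻¹ * (lam hN D' hk cf i')⁻¹)
            * Real.exp (-(δ * min (rho hN D hk i ⟨i'.1, hi'.2.1⟩) (rho hN D' hk ⟨i.1, hi.2.2⟩ i')))
          + S * ((lam hN D hk cf i)⁻¹ * (lam hN D' hk cf i')⁻¹)
            * Real.exp (-(δ * min (rho hN D hk i ⟨i'.1, hi'.2.1⟩) (rho hN D' hk ⟨i.1, hi.2.2⟩ i'))) :=
          add_le_add (ha.trans (mul_le_mul_of_nonneg_left hea hF)) (hb.trans (mul_le_mul_of_nonneg_left heb hF))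
      _ = _ := by ring
  have hK : 0 ≤ S ^ 2 * (CΔ + A') * Real.exp (δ / 2 * (2 * (ℓ : ℝ) + 11)) * (Ks * Ks') := by positivity
  exact B9Thm314GpFlatMultiLevelTorus.combined_bound (by positivity) hK (by positivity) h1 h2'

end Sum

end Literature.MathematicalPhysics.QuantumFieldTheory.Balaban1983to89.B9Thm314QGQInvFlatV1Transfer

end
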